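import Mathlib
import Summits.ResolutionOfSingularities.ResolutionOfSingularities.Theorems.HomologicalConductorPersistenceGradedTransferPairing
import Summits.ResolutionOfSingularities.ResolutionOfSingularities.Theorems.HomologicalConductorPersistenceCyclicQuotientSurface
import Literature.RingTheory.CohomologyAnnihilator.RegularRing
import HarnessLib

/-!
# Rung S-2 `PersistenceSurface` (stmt-ResolutionOfSingularities-19970) — the CYCLIC QUOTIENT SURFACE
# `k[u,v]^{(n; 1,q)}` in EVERY CHARACTERISTIC: the engines' monomial criterion with no root of unity and no
# `n ∈ kˣ` (the `p ∣ n` cyclic arrivals; cell C2 / K-PCC F5–F6; res-L1-w44b-stub-1 gen 6)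

Route `ResolutionOfSingularities/HomologicalConductor`, chain W4.4b (cell res-hironaka).  `[OURS · L1 w44b]` replaces
the role of no printed item; NOT a statement of the manuscript under review (Hironaka 2017), nothing here is
attributed to its author; folklore algebra, AI-written (weaker than expert review).

## Content

Stub-4's part 13 (`…PersistenceCyclicQuotientSurface`) instantiates the cyclic transfer at `V = k[u,v]`, `G = μ_n`
acting through a primitive `n`-th root of unity `ζ ∈ k` — which requires `n ∈ kˣ`.  The step-2/3 engines, however,
meet cyclic arrivals `1/n(1,q)` with `p = char k ∣ n` as well (tri-2 R67), where `μ_n` is non-reduced but the ring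
of invariants is the SAME monomial algebra `U = k[uⁱvʲ : n ∣ i + qj]`.  This file replaces the group by the
`ZMod n`-GRADING `deg uⁱvʲ = i + qj (mod n)` (Mathlib's `weightedHomogeneousComponent` with weights `(1, q)` in
`ZMod n`) and runs the Reynolds-free transfer of `…PersistenceGradedTransfer{,Coinduced,Pairing}`:

* `isNoetherianRing_of_retract` — a ring retract (`U`-linear `ρ : V → U`, `ρ ∘ algebraMap = id`) of a noetherian
  ring is noetherian (purity `IV ∩ U = I`; removes the `IsNoetherianRing U` instance hypothesis of part 13).
* `exists_grading` — the grading data over the degree-`0` subalgebra `U` (`p ∈ U ↔ p₀ = p`): `U`-linear projectors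
  `eₓ`, `∑ eₓ = id`, `eₓ e_y = δ e_y`, `V_x V_y ⊆ V_{x+y}`, `e₀ 1 = 1`, `V₀ = U`, the retraction `ρ`.
* `hbig_weighted` — (BIG): `u^{t}` and `v^{s}` (`qs ≡ t`) have degree `t` and no height-one prime contains both.
* **`mem_cohomologyAnnihilatorOfDegree_three_of_decomp`** — AUSLANDER'S LAW (sufficiency) for `1/n(1,q)` in every
  characteristic: `x ∈ U` with `x = ∑ⱼ bⱼ b′ⱼ`, `deg b′ⱼ = −a`, for every residue `a` ⇒ `x ∈ ca³(U)`.
* **`monomial_mem_cohomologyAnnihilatorOfDegree_three`**, `monomial_mem_cohomologyAnnihilator` — THE ENGINES'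
  CRITERION, char-free and with NO instance hypotheses: an invariant monomial `uⁱvʲ` whose divisors realise every
  residue mod `n` lies in `ca³(U) ⊆ ca(U)`.

References (mechanism only): S. B. Iyengar, R. Takahashi, IMRN 2016, arXiv:1404.1476 [`IyengarTakahashi2014`];
M. Auslander, Trans. AMS 293 (1986); folklore.
-/

noncomputable section

-- single-problem summit: the doubled namespace component `ResolutionOfSingularities` is forced
set_option linter.dupNamespace false

namespace Summit.ResolutionOfSingularities.ResolutionOfSingularities.Theorems.HomologicalConductor.PersistenceCyclicQuotientCharFree

open Finset CategoryTheory MvPolynomial Literature.RingTheory.CohomologyAnnihilator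
open Summit.ResolutionOfSingularities.ResolutionOfSingularities.Theorems.HomologicalConductor.PersistenceGradedTransfer
open Summit.ResolutionOfSingularities.ResolutionOfSingularities.Theorems.HomologicalConductor.PersistenceCyclicQuotientSurface

universe u

/-! ## Ring retracts of noetherian rings -/

/-- **A ring retract of a noetherian ring is noetherian**: if `ρ : V → U` is `U`-linear with `ρ(algebraMap u) = u`
and `V` is noetherian, so is `U` (`I ↦ IV` is an order embedding since `ρ(IV) ⊆ I`). [folklore] -/
theorem isNoetherianRing_of_retract {U V : Type*} [CommRing U] [CommRing V] [Algebra U V] [IsNoetherianRing V]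
    (ρ : V →ₗ[U] U) (hρ : ∀ u, ρ (algebraMap U V u) = u) : IsNoetherianRing U := by
  -- purity: `ρ` maps `I V` into `I`
  have hpure : ∀ (I : Ideal U) (v : V), v ∈ I.map (algebraMap U V) → ρ v ∈ I := by
    intro I v hv
    have h1 : v ∈ I • (⊤ : Submodule U V) := by rw [Ideal.smul_top_eq_map]; exact hv
    have h2 : ρ v ∈ (I • (⊤ : Submodule U V)).map ρ := Submodule.mem_map_of_mem h1
    rw [Submodule.map_smul''] at h2
    have h3 : I • (⊤ : Submodule U V).map ρ ≤ I :=
      (Submodule.smul_mono le_rfl le_top).trans (by rw [Ideal.smul_eq_mul, Ideal.mul_top])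
    exact h3 h2
  have hemb : ∀ I J : Ideal U, I.map (algebraMap U V) ≤ J.map (algebraMap U V) → I ≤ J := fun I J h x hx => by
    have := hpure J _ (h (Ideal.mem_map_of_mem _ hx))
    rwa [hρ] at this
  have hmono : StrictMono fun I : Ideal U => I.map (algebraMap U V) := fun I J hIJ =>
    lt_of_le_of_ne (Ideal.map_mono hIJ.le) fun h => hIJ.ne (le_antisymm hIJ.le (hemb J I h.symm.le))
  haveI : WellFoundedGT (Ideal V) := isNoetherian_iff'.mp inferInstance
  exact isNoetherian_iff'.mpr hmono.wellFoundedGT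

/-! ## The `ZMod n`-grading of `k[u,v]` with weights `(1, q)` -/

variable {k : Type u} [Field k] {n : ℕ} [NeZero n] (q : ℕ)

/-- The `k`-level grading identities for `E_x = weightedHomogeneousComponent (1,q) x`, `x ∈ ZMod n`:
`∑ E_x = id`, `E_x E_y = δ E_y`, `V_x V_y ⊆ V_{x+y}`, `E_0 1 = 1`. [folklore] -/
theorem weightedHomogeneousComponent_grading :
    (∀ p : MvPolynomial (Fin 2) k, ∑ x : ZMod n, weightedHomogeneousComponent (![1, (q : ZMod n)]) x p = p) ∧
    (∀ (x y : ZMod n) (p : MvPolynomial (Fin 2) k),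
      weightedHomogeneousComponent (![1, (q : ZMod n)]) x (weightedHomogeneousComponent (![1, (q : ZMod n)]) y p) =
        if x = y then weightedHomogeneousComponent (![1, (q : ZMod n)]) y p else 0) ∧
    (∀ (x y : ZMod n) (v w : MvPolynomial (Fin 2) k), weightedHomogeneousComponent (![1, (q : ZMod n)]) x v = v →
      weightedHomogeneousComponent (![1, (q : ZMod n)]) y w = w →
      weightedHomogeneousComponent (![1, (q : ZMod n)]) (x + y) (v * w) = v * w) ∧
    weightedHomogeneousComponent (![1, (q : ZMod n)]) 0 (1 : MvPolynomial (Fin 2) k) = 1 := by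
  refine ⟨fun p => ?_, fun x y p => ?_, fun x y v w hv hw => ?_, ?_⟩
  · rw [← finsum_eq_sum_of_fintype]
    exact sum_weightedHomogeneousComponent _ p
  · exact weightedHomogeneousComponent_of_mem (weightedHomogeneousComponent_mem _ p y)
  · have hv' : IsWeightedHomogeneous (![1, (q : ZMod n)]) v x := by
      rw [← hv]; exact weightedHomogeneousComponent_isWeightedHomogeneous x v
    have hw' : IsWeightedHomogeneous (![1, (q : ZMod n)]) w y := by
      rw [← hw]; exact weightedHomogeneousComponent_isWeightedHomogeneous y w
    exact weightedHomogeneousComponent_eq_self (hv'.mul hw')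
  · exact weightedHomogeneousComponent_eq_self (isWeightedHomogeneous_one k _)

/-- **The grading data over the degree-`0` subalgebra.**  For `U ⊆ k[u,v]` with `p ∈ U ↔ p₀ = p` (degree for the
weights `(1,q)` in `ZMod n`): `U`-linear projectors `eₓ` (the weighted homogeneous components), with `∑ eₓ = id`,
`eₓ e_y = δ_{xy} e_y`, `V_x V_y ⊆ V_{x+y}`, `e₀ 1 = 1`, `V₀ = algebraMap(U)`, and the `U`-linear retraction `ρ`
(`algebraMap (ρ v) = e₀ v`). [OURS · L1 w44b] -/
theorem exists_grading (U : Subalgebra k (MvPolynomial (Fin 2) k))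
    (hU : ∀ p, p ∈ U ↔ weightedHomogeneousComponent (![1, (q : ZMod n)]) 0 p = p) :
    ∃ (e : ZMod n → (MvPolynomial (Fin 2) k →ₗ[U] MvPolynomial (Fin 2) k))
      (ρ : MvPolynomial (Fin 2) k →ₗ[U] U),
      (∀ x p, e x p = weightedHomogeneousComponent (![1, (q : ZMod n)]) x p) ∧
      (∀ p, ∑ x, e x p = p) ∧
      (∀ x y p, e x (e y p) = if x = y then e y p else 0) ∧
      (∀ x y (v w : MvPolynomial (Fin 2) k), e x v = v → e y w = w → e (x + y) (v * w) = v * w) ∧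
      e 0 1 = 1 ∧
      (∀ v, e 0 v = v → ∃ r : U, algebraMap U (MvPolynomial (Fin 2) k) r = v) ∧
      (∀ v, algebraMap U (MvPolynomial (Fin 2) k) (ρ v) = e 0 v) := by
  obtain ⟨hE_sum, hE_proj, hE_mul, hE_one⟩ := weightedHomogeneousComponent_grading (k := k) (n := n) q
  -- degree-0 elements act compatibly with every component (shift lemma at `d - 0 = d`)
  have hlin : ∀ (u : U) (x : ZMod n) (p : MvPolynomial (Fin 2) k),
      weightedHomogeneousComponent (![1, (q : ZMod n)]) x ((u : MvPolynomial (Fin 2) k) * p) =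
        (u : MvPolynomial (Fin 2) k) * weightedHomogeneousComponent (![1, (q : ZMod n)]) x p := by
    intro u x p
    have h := proj_mul_eq_of_graded (U := k) (fun x : ZMod n => weightedHomogeneousComponent (![1, (q : ZMod n)]) x)
      hE_sum hE_proj hE_mul ((hU u).mp u.2) x p
    rwa [sub_zero] at h
  let e : ZMod n → (MvPolynomial (Fin 2) k →ₗ[U] MvPolynomial (Fin 2) k) := fun x =>
    { toFun := fun p => weightedHomogeneousComponent (![1, (q : ZMod n)]) x p
      map_add' := fun p p' => map_add _ p p'
      map_smul' := fun u p => by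
        rw [RingHom.id_apply, Algebra.smul_def, Algebra.smul_def]
        exact hlin u x p }
  have he : ∀ x p, e x p = weightedHomogeneousComponent (![1, (q : ZMod n)]) x p := fun _ _ => rfl
  let ρ : MvPolynomial (Fin 2) k →ₗ[U] U :=
    { toFun := fun v => ⟨weightedHomogeneousComponent (![1, (q : ZMod n)]) 0 v,
        (hU _).mpr (by rw [hE_proj, if_pos rfl])⟩
      map_add' := fun v v' => Subtype.ext (map_add _ v v')
      map_smul' := fun u v => Subtype.ext (by
        rw [RingHom.id_apply, Algebra.smul_def, smul_eq_mul]
        exact hlin u 0 v) }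
  refine ⟨e, ρ, he, hE_sum, hE_proj, hE_mul, hE_one, fun v hv => ⟨⟨v, (hU v).mpr hv⟩, rfl⟩, fun v => rfl⟩

/-! ## (BIG): every degree is realised off each height-one prime -/

/-- **(BIG) for the `(1,q)`-grading, `gcd(q,n) = 1`**: for every residue `x` and every height-one prime
`P ⊂ k[u,v]`, one of `u^{x.val}`, `v^{s}` (`q s ≡ x`) has degree `x` and avoids `P` (no height-one prime contains
both `u` and `v`). [OURS · L1 w44b] -/
theorem hbig_weighted {q : ℕ} (hq : q.Coprime n) (x : ZMod n) (P : Ideal (MvPolynomial (Fin 2) k)) (hP : P.IsPrime)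
    (hP1 : P.height = 1) :
    ∃ m : MvPolynomial (Fin 2) k, weightedHomogeneousComponent (![1, (q : ZMod n)]) x m = m ∧ m ∉ P := by
  have hX : ∀ i : Fin 2, IsWeightedHomogeneous (![1, (q : ZMod n)]) (X i : MvPolynomial (Fin 2) k)
      ((![1, (q : ZMod n)]) i) := fun i => isWeightedHomogeneous_X k _ i
  -- `u ^ x.val` has degree `x`
  have hu : IsWeightedHomogeneous (![1, (q : ZMod n)]) ((X 0 : MvPolynomial (Fin 2) k) ^ x.val) x := by
    have h := (hX 0).pow x.val
    rwa [Matrix.cons_val_zero, nsmul_eq_mul, mul_one, ZMod.natCast_zmod_val] at h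
  -- `v ^ s` has degree `x` for `s = (x q⁻¹).val`
  let qu : (ZMod n)ˣ := ZMod.unitOfCoprime q hq
  have hv : IsWeightedHomogeneous (![1, (q : ZMod n)])
      ((X 1 : MvPolynomial (Fin 2) k) ^ (x * (qu⁻¹ : (ZMod n)ˣ)).val) x := by
    have h := (hX 1).pow (x * (qu⁻¹ : (ZMod n)ˣ) : ZMod n).val
    rwa [Matrix.cons_val_one, Matrix.cons_val_fin_one, nsmul_eq_mul, ZMod.natCast_zmod_val,
      show ((q : ℕ) : ZMod n) = (qu : ZMod n) from (ZMod.coe_unitOfCoprime q hq).symm, Units.inv_mul_cancel_right]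
      at h
  by_contra hcon
  push Not at hcon
  have h0 := hcon _ (weightedHomogeneousComponent_eq_self hu)
  have h1 := hcon _ (weightedHomogeneousComponent_eq_self hv)
  exact not_X_mem_and_X_mem hP hP1 ⟨hP.mem_of_pow_mem _ h0, hP.mem_of_pow_mem _ h1⟩

/-! ## Auslander's law (sufficiency) and the engines' criterion, every characteristic -/

/-- **AUSLANDER'S LAW for `1/n(1,q)`, sufficiency, in EVERY characteristic.**  `U ⊆ k[u,v]` the degree-`0`
subalgebra for the weights `(1,q)` mod `n`, `gcd(q,n) = 1`, `k` ANY field.  If `x ∈ U` is, for every residue `a`,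
a sum `∑ⱼ bⱼ b′ⱼ` with `deg b′ⱼ = −a`, then `x ∈ ca³(U)`.  No root of unity, no `n ∈ kˣ`, no instance hypothesis
(`U` is noetherian as a retract of `k[u,v]`). [OURS · L1 w44b] -/
theorem mem_cohomologyAnnihilatorOfDegree_three_of_decomp {q : ℕ} (hq : q.Coprime n)
    (U : Subalgebra k (MvPolynomial (Fin 2) k))
    (hU : ∀ p, p ∈ U ↔ weightedHomogeneousComponent (![1, (q : ZMod n)]) 0 p = p) (x : U)
    (h : ∀ a : ZMod n, ∃ (m : ℕ) (b b' : Fin m → MvPolynomial (Fin 2) k),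
      (∀ j, IsWeightedHomogeneous (![1, (q : ZMod n)]) (b' j) (-a)) ∧
        ∑ j, b j * b' j = (x : MvPolynomial (Fin 2) k)) :
    x ∈ cohomologyAnnihilatorOfDegree U 3 := by
  obtain ⟨e, ρ, he, he_sum, he_proj, he_mul, he_one, he_zero, hρ⟩ := exists_grading (k := k) (n := n) q U hU
  have hinj : Function.Injective (algebraMap U (MvPolynomial (Fin 2) k)) := Subtype.val_injective
  haveI : IsNoetherianRing U := isNoetherianRing_of_retract ρ fun u => hinj (by
    rw [hρ, he]; exact (hU u).mp u.2)
  choose m b b' hb' hsum using h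
  have hV3 : cohomologyAnnihilatorOfDegree (MvPolynomial (Fin 2) k) 3 = ⊤ :=
    cohomologyAnnihilatorOfDegree_mvPolynomial_eq_top k 2
  refine mul_mem_cohomologyAnnihilatorOfDegree_three_of_graded e he_sum he_proj he_mul he_one he_zero hinj
    (fun y P hP hP1 => ?_) ρ hρ (c := 1) (by rw [hV3]; trivial) m b b' (fun a j => ?_) hsum x ?_
  · obtain ⟨m, hm, hmP⟩ := hbig_weighted (k := k) hq y P hP hP1
    exact ⟨m, by rw [he]; exact hm, hmP⟩
  · rw [he]; exact weightedHomogeneousComponent_eq_self (hb' a j)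
  · rw [mul_one]; rfl

omit [NeZero n] in
/-- The degree of a monomial `uⁱvʲ` for the weights `(1,q)` mod `n` is `i + qj`. [folklore] -/
theorem isWeightedHomogeneous_X_pow_mul_X_pow (i j : ℕ) :
    IsWeightedHomogeneous (![1, (q : ZMod n)]) ((X 0 : MvPolynomial (Fin 2) k) ^ i * X 1 ^ j)
      (((i + q * j : ℕ) : ZMod n)) := by
  have h := ((isWeightedHomogeneous_X k (![1, (q : ZMod n)]) (0 : Fin 2)).pow i).mul
    ((isWeightedHomogeneous_X k (![1, (q : ZMod n)]) (1 : Fin 2)).pow j)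
  simp only [Matrix.cons_val_zero, Matrix.cons_val_one, Matrix.cons_val_fin_one, nsmul_eq_mul, mul_one] at h
  convert h using 1
  push_cast; ring

/-- **THE ENGINES' CRITERION AT A CYCLIC ARRIVAL, EVERY CHARACTERISTIC** (`kstar.cyclic_ca_contains`, `cycca.py`,
tri-2 R67 «`p ∣ n`»): for `U = k[u,v]^{(n;1,q)}` the degree-`0` subalgebra (`gcd(q,n) = 1`, `k` any field), an
invariant monomial `uⁱvʲ ∈ U` admitting for every residue `a` mod `n` a divisor `u^{i₁}v^{j₁}` (`i₁ ≤ i`, `j₁ ≤ j`)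
of degree `i₁ + q j₁ ≡ a` lies in `ca³(U)`.  Stub-4's `…CyclicQuotientSurface.monomial_mem_…` minus the primitive
root, `n ∈ kˣ` and both instance hypotheses. [OURS · L1 w44b] -/
theorem monomial_mem_cohomologyAnnihilatorOfDegree_three {q : ℕ} (hq : q.Coprime n)
    (U : Subalgebra k (MvPolynomial (Fin 2) k))
    (hU : ∀ p, p ∈ U ↔ weightedHomogeneousComponent (![1, (q : ZMod n)]) 0 p = p) (i j : ℕ)
    (hmem : (X 0 ^ i * X 1 ^ j : MvPolynomial (Fin 2) k) ∈ U)
    (hdiv : ∀ a : ZMod n, ∃ i₁ j₁ : ℕ, i₁ ≤ i ∧ j₁ ≤ j ∧ ((i₁ + q * j₁ : ℕ) : ZMod n) = a) :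
    (⟨X 0 ^ i * X 1 ^ j, hmem⟩ : U) ∈ cohomologyAnnihilatorOfDegree U 3 := by
  -- the monomial is invariant: `i + q j ≡ 0`
  have hij : ((i + q * j : ℕ) : ZMod n) = 0 := by
    have h0 : IsWeightedHomogeneous (![1, (q : ZMod n)]) ((X 0 : MvPolynomial (Fin 2) k) ^ i * X 1 ^ j) 0 := by
      rw [← (hU _).mp hmem]; exact weightedHomogeneousComponent_isWeightedHomogeneous 0 _
    have hne : ((X 0 : MvPolynomial (Fin 2) k) ^ i * X 1 ^ j) ≠ 0 :=
      mul_ne_zero (pow_ne_zero _ (X_ne_zero 0)) (pow_ne_zero _ (X_ne_zero 1))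
    exact (IsWeightedHomogeneous.inj_right hne (isWeightedHomogeneous_X_pow_mul_X_pow (k := k) (n := n) q i j)
      h0)
  refine mem_cohomologyAnnihilatorOfDegree_three_of_decomp hq U hU _ fun a => ?_
  obtain ⟨i₁, j₁, hi, hj, ha⟩ := hdiv a
  refine ⟨1, fun _ => X 0 ^ i₁ * X 1 ^ j₁, fun _ => X 0 ^ (i - i₁) * X 1 ^ (j - j₁), fun _ => ?_, ?_⟩
  · convert isWeightedHomogeneous_X_pow_mul_X_pow (k := k) (n := n) q (i - i₁) (j - j₁) using 1
    rw [eq_comm, eq_neg_iff_add_eq_zero, ← ha, ← Nat.cast_add,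
      show i - i₁ + q * (j - j₁) + (i₁ + q * j₁) = i + q * j by zify [hi, hj]; ring]
    exact hij
  · rw [Fin.sum_univ_one]
    change X 0 ^ i₁ * X 1 ^ j₁ * (X 0 ^ (i - i₁) * X 1 ^ (j - j₁)) = X 0 ^ i * X 1 ^ j
    rw [mul_mul_mul_comm, ← pow_add, ← pow_add, Nat.add_sub_cancel' hi, Nat.add_sub_cancel' hj]

/-- **The same, `ca`-form**: the monomial lies in `ca(U)`. [OURS · L1 w44b] -/
theorem monomial_mem_cohomologyAnnihilator {q : ℕ} (hq : q.Coprime n) (U : Subalgebra k (MvPolynomial (Fin 2) k))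
    (hU : ∀ p, p ∈ U ↔ weightedHomogeneousComponent (![1, (q : ZMod n)]) 0 p = p) (i j : ℕ)
    (hmem : (X 0 ^ i * X 1 ^ j : MvPolynomial (Fin 2) k) ∈ U)
    (hdiv : ∀ a : ZMod n, ∃ i₁ j₁ : ℕ, i₁ ≤ i ∧ j₁ ≤ j ∧ ((i₁ + q * j₁ : ℕ) : ZMod n) = a) :
    (⟨X 0 ^ i * X 1 ^ j, hmem⟩ : U) ∈ cohomologyAnnihilator U :=
  cohomologyAnnihilatorOfDegree_le (R := U) 3 (monomial_mem_cohomologyAnnihilatorOfDegree_three hq U hU i j hmem hdiv)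

end Summit.ResolutionOfSingularities.ResolutionOfSingularities.Theorems.HomologicalConductor.PersistenceCyclicQuotientCharFree

end
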